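import Summits.Ventures.CertifiedManyBodySolver.Observables.PairLROOnePointWitness
import Literature.MathematicalPhysics.QuantumLattice.PairCorrelationsProofs
import Literature.MathematicalPhysics.QuantumLattice.PairFieldMomentum
import Literature.MathematicalPhysics.QuantumLattice.HubbardModelParticleHoleProofs
import HarnessLib

/-!
# One-point witness, part 3: the lattice instance (`pairField`, `totalNumber`, sector ground states)

HONEST FRAMING: first certified bounds on pairing observables; not a superconductivity verdict;
every number certified (two lineages + referee) or labelled float. Crew hubbard-obs (D-0042), seat
hubbard-obs-p1 (`prover-hubbard-obs-p1-g4-0`). Zero compute; no definition, no named fact, no `sorry`.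

Instantiates `PairLROOnePointWitness.lean` with `Nop = totalNumber`, `P = pairField g L` (charge `-2`:
`totalNumber_commutator_pairField`, from `totalNumber_commutator_localPair`), `H` any Hermitian matrix on
the torus Fock space and `ψ` a normalised ground state of `H` in a sector `(N, S^z = M)`
(`IsGroundStateInSector`):

* `exists_pairField_onePointWitness` — the Horsch–von der Linden / KHvdL superposition
  `Ξ = (ψ + Oψ/‖Oψ‖)/√2`, `O = P + Pᴴ`: unit vector, one-point amplitude `Re⟨Ξ,PΞ⟩ = ‖Oψ‖₂/2` with
  `‖Oψ‖₂² = Re⟨ψ,PᴴPψ⟩ + Re⟨ψ,PPᴴψ⟩`, energy `Re⟨Ξ,HΞ⟩ ≤ E + ‖[H,O]ψ‖₂/(2‖Oψ‖₂)`, mean particle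
  number `N + Re⟨ψ,(PPᴴ − PᴴP)ψ⟩/‖Oψ‖₂²`, neutral expectations averaged, lattice-translation
  covariant;
* `re_expect_pairField_le_of_onePointCeiling` (and `…_doubleCommutator`, the form whose constants are
  `O(L²)` by locality) — **the reduction the cell uses**: a ceiling `M₁` on
  `Re⟨ζ, P ζ⟩` over all unit vectors `ζ` with `Re⟨ζ,Hζ⟩ ≤ E + β/(2a₀)` and `|Re⟨ζ,Nζ⟩ − N| ≤ γ/a₀²`
  (`β ≥ ‖[H,O]ψ‖₂`, `γ ≥ |Re⟨ψ,[P,Pᴴ]ψ⟩|`, `0 < a₀ ≤ ‖Oψ‖₂`) gives `Re⟨ψ,PᴴPψ⟩ + Re⟨ψ,PPᴴψ⟩ ≤ 4M₁²`.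
  On the `L`-torus `β, γ = O(L²)` (locality) and `a₀ = √c·L²` under `cL⁴ ≤ Re⟨ψ,PᴴPψ⟩`, so the class
  is: energy within `O(1)` of the sector ground energy, particle number within `O(L⁻²)` of `N`, and a
  certified ceiling `M` on the one-point DENSITY `Re⟨P⟩/L²` reads `⟨PᴴP⟩/L⁴ ≤ 2M² + O(L⁻²)` — the
  constant of route AbsenceCertificate's `SourcedOrderDominatesLRO`, without source field,
  `h`-extrapolation or ensemble-equivalence clause. The locality constants and the
  thermodynamic-limit row format are NOT in this file.

References: T. Koma, H. Tasaki, J. Stat. Phys. 76 (1994) 745, §2.2 Theorem 2.2; T. A. Kaplan,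
P. Horsch, W. von der Linden, J. Phys. Soc. Jpn. 58 (1989) 3894; D. J. Scalapino, Phys. Rep. 250
(1995) 329, §2 (the pair field).
-/

noncomputable section

open Matrix Complex
open scoped ComplexOrder ComplexConjugate

namespace Summit.Ventures.CertifiedManyBodySolver.Observables

open Literature.MathematicalPhysics.QuantumLattice

section Lattice

/-! ### The lattice instance: `P = pairField g L`, `Nop = totalNumber`, charge `q = 2` -/

open Literature.Probability.LatticeModels

variable (g : Site 2 → ℝ) (L : ℕ) [NeZero L]

/-- The pair field has charge `-2`: `[N, Δ_g] = -2 Δ_g` (sum of `totalNumber_commutator_localPair`).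
[cite: Scalapino1995, §2 (2.2)] -/
theorem totalNumber_commutator_pairField :
    totalNumber * pairField g L - pairField g L * totalNumber = ((-2 : ℝ) : ℂ) • pairField g L := by
  have h : totalNumber * pairField g L - pairField g L * totalNumber = (-2 : ℂ) • pairField g L := by
    unfold pairField
    exact commutator_sum_eq_smul _ _ _ _ fun x _ => totalNumber_commutator_localPair g L x
  rw [h]; push_cast; rfl

variable {g L}

/-- The single-commutator energy term of the witness in double-commutator form: for `H`, `O` Hermitian
and `Hψ = Eψ`, `⟨Oψ, [H,O]ψ⟩ = ½ ⟨ψ, [O,[H,O]] ψ⟩` (Horsch–von der Linden).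
[cite: KomaTasaki1994, Theorem 2.2 proof] -/
theorem star_mulVec_dotProduct_commutator_eq_half_doubleCommutator
    {n : Type*} [Fintype n] {H O : Matrix n n ℂ} (hH : H.IsHermitian) (hO : O.IsHermitian)
    {ψ : n → ℂ} {E : ℝ} (hHψ : H *ᵥ ψ = (E : ℂ) • ψ) :
    star (O *ᵥ ψ) ⬝ᵥ ((H * O - O * H) *ᵥ ψ) =
      (1 / 2 : ℂ) * (star ψ ⬝ᵥ ((O * (H * O - O * H) - (H * O - O * H) * O) *ᵥ ψ)) := by
  rw [dotProduct_doubleCommutator hH hO hHψ, sub_mulVec, ← mulVec_mulVec, ← mulVec_mulVec, hHψ,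
    mulVec_smul, dotProduct_sub, dotProduct_smul, smul_eq_mul]
  ring

/-- **One-point witness for the pair field of a sector eigenvector.** Let `H` be any Hermitian matrix
on the Fock space of the `L × L` torus, `ψ` a normalised ground state of `H` in the sector
`(N, S^z = M)` (so `Hψ = Eψ`, `E = minEnergyOn`, and `totalNumber ψ = Nψ`), `P = pairField g L`,
`O = P + Pᴴ`, and assume `Oψ ≠ 0` (e.g. `⟨ψ, PᴴPψ⟩ > 0`). Then there is a unit vector `Ξ` — the
Horsch–von der Linden / KHvdL superposition `(ψ + Oψ/‖Oψ‖)/√2`, a superposition of the sectors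
`N` and `N ± 2` — with one-point amplitude `Re⟨Ξ,PΞ⟩ = ‖Oψ‖₂/2`, where
`‖Oψ‖₂² = Re⟨ψ,PᴴPψ⟩ + Re⟨ψ,PPᴴψ⟩`; energy `⟨Ξ,HΞ⟩ = E + ⟨Oψ,[H,O]ψ⟩/(2‖Oψ‖²) ≤ E + ‖[H,O]ψ‖₂/(2‖Oψ‖₂)`;
mean particle number `N + Re⟨ψ,(PPᴴ − PᴴP)ψ⟩/‖Oψ‖₂²`; every number-conserving expectation the
average of those of `ψ` and of `Oψ/‖Oψ‖`; and the same eigenvalue as `ψ` under every `T` with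
`Tψ = cψ` commuting with `P` and `Pᴴ` (lattice translations). [cite: KomaTasaki1994, Theorem 2.2 (2.9)]
[cite: KaplanHorschVonDerLinden1989] -/
theorem exists_pairField_onePointWitness
    {H : Matrix (Finset (Orb (FermionTorus 2 L))) (Finset (Orb (FermionTorus 2 L))) ℂ}
    (hH : H.IsHermitian) {N : ℕ} {M : ℝ} {ψ : Fock (Orb (FermionTorus 2 L))}
    (hψ1 : star ψ ⬝ᵥ ψ = 1) (hgs : IsGroundStateInSector H N M ψ)
    (hw : (pairField g L + (pairField g L)ᴴ) *ᵥ ψ ≠ 0) :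
    eucNorm ((pairField g L + (pairField g L)ᴴ) *ᵥ ψ) ^ 2 =
        (expect ((pairField g L)ᴴ * pairField g L) ψ).re +
          (expect (pairField g L * (pairField g L)ᴴ) ψ).re ∧
    ∃ Ξ : Fock (Orb (FermionTorus 2 L)), star Ξ ⬝ᵥ Ξ = 1 ∧
      (expect (pairField g L) Ξ).re = eucNorm ((pairField g L + (pairField g L)ᴴ) *ᵥ ψ) / 2 ∧
      expect H Ξ = ((H.minEnergyOn (szSector N M) : ℝ) : ℂ) +
        star ((pairField g L + (pairField g L)ᴴ) *ᵥ ψ) ⬝ᵥ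
            ((H * (pairField g L + (pairField g L)ᴴ) - (pairField g L + (pairField g L)ᴴ) * H) *ᵥ ψ) /
          (2 * ((eucNorm ((pairField g L + (pairField g L)ᴴ) *ᵥ ψ) ^ 2 : ℝ) : ℂ)) ∧
      (expect H Ξ).re ≤ H.minEnergyOn (szSector N M) +
        eucNorm ((H * (pairField g L + (pairField g L)ᴴ) - (pairField g L + (pairField g L)ᴴ) * H) *ᵥ ψ) /
          (2 * eucNorm ((pairField g L + (pairField g L)ᴴ) *ᵥ ψ)) ∧
      (expect H Ξ).re = H.minEnergyOn (szSector N M) +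
        (expect ((pairField g L + (pairField g L)ᴴ) * (H * (pairField g L + (pairField g L)ᴴ) -
              (pairField g L + (pairField g L)ᴴ) * H) -
            (H * (pairField g L + (pairField g L)ᴴ) - (pairField g L + (pairField g L)ᴴ) * H) *
              (pairField g L + (pairField g L)ᴴ)) ψ).re /
          (4 * eucNorm ((pairField g L + (pairField g L)ᴴ) *ᵥ ψ) ^ 2) ∧
      (expect totalNumber Ξ).re = N +
        2 * (expect (pairField g L * (pairField g L)ᴴ - (pairField g L)ᴴ * pairField g L) ψ).re /
          (2 * eucNorm ((pairField g L + (pairField g L)ᴴ) *ᵥ ψ) ^ 2) ∧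
      (∀ X : Matrix (Finset (Orb (FermionTorus 2 L))) (Finset (Orb (FermionTorus 2 L))) ℂ,
        X * totalNumber = totalNumber * X →
        expect X Ξ = expect X ψ / 2 +
          star ((pairField g L + (pairField g L)ᴴ) *ᵥ ψ) ⬝ᵥ
              (X *ᵥ ((pairField g L + (pairField g L)ᴴ) *ᵥ ψ)) /
            (2 * ((eucNorm ((pairField g L + (pairField g L)ᴴ) *ᵥ ψ) ^ 2 : ℝ) : ℂ))) ∧
      (∀ (T : Matrix (Finset (Orb (FermionTorus 2 L))) (Finset (Orb (FermionTorus 2 L))) ℂ) (c : ℂ),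
        T *ᵥ ψ = c • ψ → T * pairField g L = pairField g L * T →
        T * (pairField g L)ᴴ = (pairField g L)ᴴ * T → T *ᵥ Ξ = c • Ξ) := by
  obtain ⟨hmem, -, hHψ⟩ := hgs
  have hN : totalNumber *ᵥ ψ = ((N : ℝ) : ℂ) • ψ := by
    rw [totalNumber_mulVec_of_isNParticle ((mem_szSector_iff N M ψ).1 hmem).1]; push_cast; rfl
  have hNP := totalNumber_commutator_pairField g L
  have h2 : (2 : ℝ) ≠ 0 := two_ne_zero
  refine ⟨eucNorm_sq_add_conjTranspose_mulVec totalNumber_isHermitian hNP h2 hN, ?_⟩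
  obtain ⟨Ξ, h1, h2', h3, h4, h5, h6, h7⟩ :=
    exists_onePointWitness hH totalNumber_isHermitian hNP h2 hψ1 hHψ hN hw
  have hO : (pairField g L + (pairField g L)ᴴ).IsHermitian := Matrix.isHermitian_add_transpose_self _
  have h3' : (expect H Ξ).re = H.minEnergyOn (szSector N M) +
      (expect ((pairField g L + (pairField g L)ᴴ) * (H * (pairField g L + (pairField g L)ᴴ) -
            (pairField g L + (pairField g L)ᴴ) * H) -
          (H * (pairField g L + (pairField g L)ᴴ) - (pairField g L + (pairField g L)ᴴ) * H) *
            (pairField g L + (pairField g L)ᴴ)) ψ).re /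
        (4 * eucNorm ((pairField g L + (pairField g L)ᴴ) *ᵥ ψ) ^ 2) := by
    have e : expect H Ξ = ((H.minEnergyOn (szSector N M) : ℝ) : ℂ) +
        expect ((pairField g L + (pairField g L)ᴴ) * (H * (pairField g L + (pairField g L)ᴴ) -
            (pairField g L + (pairField g L)ᴴ) * H) -
          (H * (pairField g L + (pairField g L)ᴴ) - (pairField g L + (pairField g L)ᴴ) * H) *
            (pairField g L + (pairField g L)ᴴ)) ψ /
          ((4 * eucNorm ((pairField g L + (pairField g L)ᴴ) *ᵥ ψ) ^ 2 : ℝ) : ℂ) := by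
      rw [show expect H Ξ = star Ξ ⬝ᵥ (H *ᵥ Ξ) from rfl, h3,
        star_mulVec_dotProduct_commutator_eq_half_doubleCommutator hH hO hHψ]
      push_cast
      unfold expect
      field_simp
      ring
    rw [e, Complex.add_re, Complex.ofReal_re, Complex.div_ofReal_re]
  exact ⟨Ξ, h1, h2', h3, h4, h3', h5, h6, h7⟩

/-- **The lattice reduction: a certified ONE-POINT ceiling is a pair-field LRO ceiling.** With `H`,
`ψ`, `N`, `E = minEnergyOn` as above and `P = pairField g L`, `O = P + Pᴴ`: let
`β ≥ ‖[H,O]ψ‖₂`, `γ ≥ |Re⟨ψ,(PPᴴ − PᴴP)ψ⟩|`, `0 < a₀ ≤ ‖Oψ‖₂`. If every unit vector `ζ` of the Fock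
space with `Re⟨ζ,Hζ⟩ ≤ E + β/(2a₀)` and `|Re⟨ζ,Nζ⟩ − N| ≤ γ/a₀²` has `Re⟨ζ,Pζ⟩ ≤ M₁`, then
`Re⟨ψ,PᴴPψ⟩ + Re⟨ψ,PPᴴψ⟩ ≤ 4M₁²`. (On the `L`-torus `β, γ = O(L²)` by locality and
`a₀ = √c·L²` under the LRO hypothesis `cL⁴ ≤ Re⟨ψ,PᴴPψ⟩`, so the admissible class is: energy
within `O(1)` of the sector ground energy, mean particle number within `O(L⁻²)` of `N`; and the
conclusion reads `⟨PᴴP⟩/L⁴ ≤ 2M² + O(L⁻²)` for a ceiling `M = M₁/L²` on the one-point DENSITY.)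
[cite: KomaTasaki1994, Theorem 2.2] [cite: KaplanHorschVonDerLinden1989] -/
theorem re_expect_pairField_le_of_onePointCeiling
    {H : Matrix (Finset (Orb (FermionTorus 2 L))) (Finset (Orb (FermionTorus 2 L))) ℂ}
    (hH : H.IsHermitian) {N : ℕ} {M : ℝ} {ψ : Fock (Orb (FermionTorus 2 L))}
    (hψ1 : star ψ ⬝ᵥ ψ = 1) (hgs : IsGroundStateInSector H N M ψ) {β γ a₀ M₁ : ℝ}
    (hβ : eucNorm ((H * (pairField g L + (pairField g L)ᴴ) -
      (pairField g L + (pairField g L)ᴴ) * H) *ᵥ ψ) ≤ β)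
    (hγ : |(expect (pairField g L * (pairField g L)ᴴ - (pairField g L)ᴴ * pairField g L) ψ).re| ≤ γ)
    (ha₀ : 0 < a₀) (ha : a₀ ≤ eucNorm ((pairField g L + (pairField g L)ᴴ) *ᵥ ψ))
    (hceil : ∀ ζ : Fock (Orb (FermionTorus 2 L)), star ζ ⬝ᵥ ζ = 1 →
      (expect H ζ).re ≤ H.minEnergyOn (szSector N M) + β / (2 * a₀) →
      |(expect totalNumber ζ).re - N| ≤ γ / a₀ ^ 2 → (expect (pairField g L) ζ).re ≤ M₁) :
    (expect ((pairField g L)ᴴ * pairField g L) ψ).re +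
        (expect (pairField g L * (pairField g L)ᴴ) ψ).re ≤ 4 * M₁ ^ 2 := by
  obtain ⟨hmem, -, hHψ⟩ := hgs
  have hN : totalNumber *ᵥ ψ = ((N : ℝ) : ℂ) • ψ := by
    rw [totalNumber_mulVec_of_isNParticle ((mem_szSector_iff N M ψ).1 hmem).1]; push_cast; rfl
  have hNP := totalNumber_commutator_pairField g L
  have h2 : (2 : ℝ) ≠ 0 := two_ne_zero
  have hceil' : ∀ ζ : Fock (Orb (FermionTorus 2 L)), star ζ ⬝ᵥ ζ = 1 →
      (star ζ ⬝ᵥ (H *ᵥ ζ)).re ≤ H.minEnergyOn (szSector N M) + β / (2 * a₀) →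
      |(star ζ ⬝ᵥ (totalNumber *ᵥ ζ)).re - N| ≤ |(2 : ℝ)| * γ / (2 * a₀ ^ 2) →
      (star ζ ⬝ᵥ (pairField g L *ᵥ ζ)).re ≤ M₁ := by
    intro ζ hζ hE hNζ
    refine hceil ζ hζ hE ?_
    rw [abs_of_pos (by norm_num : (0:ℝ) < 2)] at hNζ
    calc |(expect totalNumber ζ).re - N| = |(star ζ ⬝ᵥ (totalNumber *ᵥ ζ)).re - N| := rfl
      _ ≤ 2 * γ / (2 * a₀ ^ 2) := hNζ
      _ = γ / a₀ ^ 2 := by field_simp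
  have hle := eucNorm_le_two_mul_of_onePointCeiling hH totalNumber_isHermitian hNP h2 hψ1 hHψ hN
    hβ hγ ha₀ ha hceil'
  have h0 : 0 ≤ eucNorm ((pairField g L + (pairField g L)ᴴ) *ᵥ ψ) := eucNorm_nonneg _
  have key := eucNorm_sq_add_conjTranspose_mulVec totalNumber_isHermitian hNP h2 hN
  calc (expect ((pairField g L)ᴴ * pairField g L) ψ).re +
        (expect (pairField g L * (pairField g L)ᴴ) ψ).re
      = eucNorm ((pairField g L + (pairField g L)ᴴ) *ᵥ ψ) ^ 2 := key.symm
    _ ≤ (2 * M₁) ^ 2 := pow_le_pow_left₀ h0 hle 2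
    _ = 4 * M₁ ^ 2 := by ring

/-- **The lattice reduction, double-commutator form** (the form whose constants are `O(L²)` by
locality, `PairFieldCommutatorLocality`): with `δ ≥ ‖⟨ψ, [O,[H,O]] ψ⟩‖`, `γ ≥ |Re⟨ψ,[P,Pᴴ]ψ⟩|`,
`0 < a₀ ≤ ‖Oψ‖₂`, a ceiling `M₁` on `Re⟨ζ,Pζ⟩` over unit `ζ` with `Re⟨ζ,Hζ⟩ ≤ E + δ/(4a₀²)` and
`|Re⟨ζ,Nζ⟩ − N| ≤ γ/a₀²` gives `Re⟨ψ,PᴴPψ⟩ + Re⟨ψ,PPᴴψ⟩ ≤ 4M₁²`. On the torus `δ, γ = O(L²)`,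
`a₀² = 2c·L⁴ − O(L²)`: the admissible class is energy within `O(L⁻²)` (TOTAL) of the sector ground energy.
[cite: KomaTasaki1994, Theorem 2.2 (2.9)] [cite: KaplanHorschVonDerLinden1989] -/
theorem re_expect_pairField_le_of_onePointCeiling_doubleCommutator
    {H : Matrix (Finset (Orb (FermionTorus 2 L))) (Finset (Orb (FermionTorus 2 L))) ℂ}
    (hH : H.IsHermitian) {N : ℕ} {M : ℝ} {ψ : Fock (Orb (FermionTorus 2 L))}
    (hψ1 : star ψ ⬝ᵥ ψ = 1) (hgs : IsGroundStateInSector H N M ψ) {δ γ a₀ M₁ : ℝ}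
    (hδ : ‖expect ((pairField g L + (pairField g L)ᴴ) * (H * (pairField g L + (pairField g L)ᴴ) -
            (pairField g L + (pairField g L)ᴴ) * H) -
          (H * (pairField g L + (pairField g L)ᴴ) - (pairField g L + (pairField g L)ᴴ) * H) *
            (pairField g L + (pairField g L)ᴴ)) ψ‖ ≤ δ)
    (hγ : |(expect (pairField g L * (pairField g L)ᴴ - (pairField g L)ᴴ * pairField g L) ψ).re| ≤ γ)
    (ha₀ : 0 < a₀) (ha : a₀ ≤ eucNorm ((pairField g L + (pairField g L)ᴴ) *ᵥ ψ))
    (hceil : ∀ ζ : Fock (Orb (FermionTorus 2 L)), star ζ ⬝ᵥ ζ = 1 →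
      (expect H ζ).re ≤ H.minEnergyOn (szSector N M) + δ / (4 * a₀ ^ 2) →
      |(expect totalNumber ζ).re - N| ≤ γ / a₀ ^ 2 → (expect (pairField g L) ζ).re ≤ M₁) :
    (expect ((pairField g L)ᴴ * pairField g L) ψ).re +
        (expect (pairField g L * (pairField g L)ᴴ) ψ).re ≤ 4 * M₁ ^ 2 := by
  set a := eucNorm ((pairField g L + (pairField g L)ᴴ) *ᵥ ψ) with hadef
  have ha_pos : 0 < a := lt_of_lt_of_le ha₀ ha
  have hw : (pairField g L + (pairField g L)ᴴ) *ᵥ ψ ≠ 0 := by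
    intro h
    rw [hadef, h, eucNorm_zero] at ha_pos
    exact lt_irrefl _ ha_pos
  obtain ⟨hsq, Ξ, hnorm, hP, -, -, hHeq, hNre, -, -⟩ := exists_pairField_onePointWitness hH hψ1 hgs hw
  have hδ0 : 0 ≤ δ := (norm_nonneg _).trans hδ
  have hγ0 : 0 ≤ γ := (abs_nonneg _).trans hγ
  have hE : (expect H Ξ).re ≤ H.minEnergyOn (szSector N M) + δ / (4 * a₀ ^ 2) := by
    rw [hHeq, ← hadef]
    have hre := (Complex.re_le_norm _).trans hδ
    have h1 : (expect ((pairField g L + (pairField g L)ᴴ) * (H * (pairField g L + (pairField g L)ᴴ) -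
            (pairField g L + (pairField g L)ᴴ) * H) -
          (H * (pairField g L + (pairField g L)ᴴ) - (pairField g L + (pairField g L)ᴴ) * H) *
            (pairField g L + (pairField g L)ᴴ)) ψ).re / (4 * a ^ 2) ≤ δ / (4 * a ^ 2) :=
      div_le_div_of_nonneg_right hre (by positivity)
    have h2 : δ / (4 * a ^ 2) ≤ δ / (4 * a₀ ^ 2) := by gcongr
    linarith
  have hNb : |(expect totalNumber Ξ).re - N| ≤ γ / a₀ ^ 2 := by
    rw [hNre, ← hadef, add_sub_cancel_left, abs_div, abs_of_pos (by positivity : 0 < 2 * a ^ 2), abs_mul,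
      abs_of_pos (by norm_num : (0:ℝ) < 2)]
    calc 2 * |(expect (pairField g L * (pairField g L)ᴴ - (pairField g L)ᴴ * pairField g L) ψ).re| / (2 * a ^ 2)
        = |(expect (pairField g L * (pairField g L)ᴴ - (pairField g L)ᴴ * pairField g L) ψ).re| / a ^ 2 := by
          field_simp
      _ ≤ γ / a ^ 2 := by gcongr
      _ ≤ γ / a₀ ^ 2 := by gcongr
  have hM := hceil Ξ hnorm hE hNb
  rw [hP, ← hadef] at hM
  have hle : a ≤ 2 * M₁ := by linarith
  have h0 : 0 ≤ a := ha_pos.le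
  calc (expect ((pairField g L)ᴴ * pairField g L) ψ).re +
        (expect (pairField g L * (pairField g L)ᴴ) ψ).re = a ^ 2 := hsq.symm
    _ ≤ (2 * M₁) ^ 2 := pow_le_pow_left₀ h0 hle 2
    _ = 4 * M₁ ^ 2 := by ring

end Lattice

end Summit.Ventures.CertifiedManyBodySolver.Observables

end
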